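import Mathlib
import HarnessLib

/-!
# Route `UnitScaleTilt`, crux K1 «MinimiserStabilityRegPr» (stmt-QuantumFields-19200), route-R [RP] curved, row (n3) N3b, file F4 —
# THE JOINT ROW FROM LEVEL MASSES (real bookkeeping at d = 3): with the G-channel damping `ρ₁ = (L³)⁻¹L = L⁻²` of ✓ F2 ∕ ✓ 1b and per-level sources
# `r_l ≤ C·M_l`, level masses `M_l ≤ A·L^{−l} + B·L^{l}` (the shape of ✓ `Prop7FibreLevelMass*`: `ρ^{2l}E²M₀` with `ρ² = L^{2−d} = L⁻¹`, and `4d·Lˡ·B_Λ²` from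
# ✓ `FibreLevelMassT3Letters.sum_normSq_covIterLambda_le_level`), the damped sum is `≤ C·A·(L²∕(L−1))·ℓ⁻¹ + C·B·(L²∕(L³−1))·ℓ`, `ℓ = L^k` — i.e. `C₁ℓ⁻¹M₀ + C₂ℓ(CURL₀ + DIV₀)`

Cell `ym3-torus`, D-0154 (3c) extra-width seat `ym-routeR-w6` (gen 3); LEAD ★p1 g14's NAMED file F4 (2026-08-28 15:11Z, «(c1′)»).  THEOREMS ONLY (0 `def`, 0 `sorry`);
`--supports stmt-QuantumFields-19200`, count-neutral.  YM₃ on T³ is a ladder rung (R3), not the Clay problem; nothing here claims the stub, the crux, d = 4 or the mass gap.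

THE POINT.  ✓ F2 `Prop7FibreLogRatioGaugedL1.sum_norm_trueLinIter_add_pureGauge_expChart_le_log` bounds the joint row modulo the coarse pure gauge by
`E_k·Σ_{l<k}ρ₁^{k−1−l}·Σ_c‖R_l(c)‖`; LEAD's F3 gives `Σ_c‖R_l(c)‖ ≤ C·M_l` (crude mass² currency); the level masses of the ratio tower obey the structure rows of
✓ `Prop7FibreLevelMass.sqrt_sum_normSq_levelRatio_le` + ✓ `…T3Letters.sum_normSq_covIterLambda_le_level`, whose d = 3 shape is `M_l ≤ A·L^{−l} + B·L^{l}` with `A ∝ E²M₀`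
and `B ∝ 4d·B_Λ²`, `B_Λ² = 200L⁴(CURL₀ + DIV₀) + 4·10⁹L⁹εℓ⁻²M₀`.  This file is the power counting: both channels are geometric FROM THE TOP, the decaying one lands on
`ℓ⁻¹M₀`, the growing one on `ℓ·(CURL₀ + DIV₀)` (+ `ε·ℓ⁻¹M₀`) — the door's JOINT currency with L-only constants (the `C₂ℓK` necessity = the `Lˡ` growth of the gauge part).

WHAT IS PROVED (ns `…Theorems.Prop7JointRowOfLevelMasses`; reals only, every input displayed).
* §1 `levelSum_damped_le` — the damped level sum of two-sided geometric sources.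
* §2 ★★ `jointRow_of_levelMasses` — with `r_l ≤ C·M_l`: `E·Σ_{l<k}(L²)^{−(k−1−l)}·r_l ≤ E·C·(A·(L²∕(L−1))·(L^k)⁻¹ + B·(L²∕(L³−1))·L^k)`.
* §3 ★★ `jointRow_currency` — with `A = c_A·M₀`, `B = c_B·(CURL + DIV) + c_B′·ε·(L^k)⁻²·M₀`: the right-hand side is `C₁·(L^k)⁻¹·M₀ + C₂·L^k·(CURL + DIV)`,
  `C₁ = E·C·(c_A·L²∕(L−1) + c_B′·ε·L²∕(L³−1))`, `C₂ = E·C·c_B·L²∕(L³−1)`.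
HONEST SCOPE.  Pure real bookkeeping; the tower instantiation (the per-level mass rows with their (B6)-shape sup hypotheses, F3's source row, F2) is the consumer's knit.

References: T. Bałaban, CMP 95 (1984) 17–40 [Balaban1984PropagatorsI] ((1.18)–(1.20) pp.19–20); CMP 102 (1985) 277–309 [Balaban1985Variational] (Prop. 7 p.299).
-/

set_option autoImplicit false

noncomputable section

open Finset

namespace Summit.QuantumFields.YangMills.Theorems.Prop7JointRowOfLevelMasses

/-! ## §1 The damped level sum -/

/-- **DAMPED LEVEL SUM OF TWO-SIDED GEOMETRIC SOURCES** (reals): if `M_l ≤ A·L^{−l} + B·L^{l}` for `l < k` (`A, B ≥ 0`, `L ≥ 2`), then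
`Σ_{l<k}(L²)^{−(k−1−l)}·M_l ≤ A·(L²∕(L−1))·L^{−k} + B·(L²∕(L³−1))·L^{k}` — geometric from the top in both channels. [folklore] -/
theorem levelSum_damped_le (L : ℝ) (hL : 2 ≤ L) (k : ℕ) (A B : ℝ) (hA : 0 ≤ A) (hB : 0 ≤ B) (M : ℕ → ℝ)
    (hM : ∀ l < k, M l ≤ A * (L ^ l)⁻¹ + B * L ^ l) :
    ∑ l ∈ range k, ((L ^ 2)⁻¹) ^ (k - 1 - l) * M l
      ≤ A * (L ^ 2 / (L - 1)) * (L ^ k)⁻¹ + B * (L ^ 2 / (L ^ 3 - 1)) * L ^ k := by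
  have hL0 : 0 < L := by linarith
  have hL1 : 1 < L := by linarith
  have hx0 : 0 ≤ (L ^ 2)⁻¹ := by positivity
  -- termwise
  have h1 : ∑ l ∈ range k, ((L ^ 2)⁻¹) ^ (k - 1 - l) * M l
      ≤ ∑ l ∈ range k, ((L ^ 2)⁻¹) ^ (k - 1 - l) * (A * (L ^ l)⁻¹ + B * L ^ l) :=
    sum_le_sum fun l hl => mul_le_mul_of_nonneg_left (hM l (mem_range.mp hl)) (pow_nonneg hx0 _)
  refine h1.trans ?_
  -- closed forms: `(L²)⁻¹^(k-1-l) · L^{-l} = L^{2-2k} · L^{l}` and `(L²)⁻¹^(k-1-l) · L^l = L^{2-2k} · L^{3l}`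
  have hterm : ∀ l ∈ range k, ((L ^ 2)⁻¹) ^ (k - 1 - l) * (A * (L ^ l)⁻¹ + B * L ^ l)
      = (L ^ 2) * (L ^ (2 * k))⁻¹ * (A * L ^ l + B * L ^ (3 * l)) := by
    intro l hl
    have hlk : l < k := mem_range.mp hl
    have hm : 2 * k = 2 * (k - 1 - l) + l + l + 2 := by omega
    rw [hm, inv_pow, ← pow_mul]
    field_simp
    ring
  rw [sum_congr rfl hterm, ← mul_sum, sum_add_distrib, ← mul_sum, ← mul_sum]
  -- geometric sums
  have hg1 : ∑ l ∈ range k, L ^ l ≤ L ^ k / (L - 1) := by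
    rw [geom_sum_eq hL1.ne']
    exact div_le_div_of_nonneg_right (by linarith) (by linarith)
  have hg3 : ∑ l ∈ range k, L ^ (3 * l) ≤ L ^ (3 * k) / (L ^ 3 - 1) := by
    have hL3 : 1 < L ^ 3 := one_lt_pow₀ hL1 (by norm_num)
    have : ∑ l ∈ range k, L ^ (3 * l) = ∑ l ∈ range k, (L ^ 3) ^ l := sum_congr rfl fun l _ => by rw [pow_mul]
    rw [this, geom_sum_eq hL3.ne', ← pow_mul]
    exact div_le_div_of_nonneg_right (by linarith) (by linarith)
  have hpos : 0 ≤ L ^ 2 * (L ^ (2 * k))⁻¹ := by positivity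
  calc L ^ 2 * (L ^ (2 * k))⁻¹ * (A * ∑ l ∈ range k, L ^ l + B * ∑ l ∈ range k, L ^ (3 * l))
      ≤ L ^ 2 * (L ^ (2 * k))⁻¹ * (A * (L ^ k / (L - 1)) + B * (L ^ (3 * k) / (L ^ 3 - 1))) :=
        mul_le_mul_of_nonneg_left (add_le_add (mul_le_mul_of_nonneg_left hg1 hA) (mul_le_mul_of_nonneg_left hg3 hB)) hpos
    _ = A * (L ^ 2 / (L - 1)) * (L ^ k)⁻¹ + B * (L ^ 2 / (L ^ 3 - 1)) * L ^ k := by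
        have hk2 : L ^ (2 * k) = L ^ k * L ^ k := by rw [two_mul, pow_add]
        have hk3 : L ^ (3 * k) = L ^ k * L ^ k * L ^ k := by rw [show 3 * k = k + k + k by ring, pow_add, pow_add]
        rw [hk2, hk3]
        field_simp

/-! ## §2 ★★ The joint row from per-level sources bounded by level masses -/

/-- ★★ **THE JOINT ROW FROM LEVEL MASSES**: `r_l ≤ C·M_l`, `M_l ≤ A·L^{−l} + B·L^{l}` (`l < k`; `A, B, C, E ≥ 0`, `L ≥ 2`) ⇒
`E·Σ_{l<k}(L²)^{−(k−1−l)}·r_l ≤ E·C·(A·(L²∕(L−1))·(L^k)⁻¹ + B·(L²∕(L³−1))·L^k)` (F2's damped source sum at d = 3, `ρ₁ = L⁻²`). [cite: Balaban1984PropagatorsI, (1.18)-(1.20) pp.19-20] -/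
theorem jointRow_of_levelMasses (L : ℝ) (hL : 2 ≤ L) (k : ℕ) {A B C E : ℝ} (hA : 0 ≤ A) (hB : 0 ≤ B) (hC : 0 ≤ C) (hE : 0 ≤ E)
    (M r : ℕ → ℝ) (hM : ∀ l < k, M l ≤ A * (L ^ l)⁻¹ + B * L ^ l) (hr : ∀ l < k, r l ≤ C * M l) :
    E * ∑ l ∈ range k, ((L ^ 2)⁻¹) ^ (k - 1 - l) * r l
      ≤ E * C * (A * (L ^ 2 / (L - 1)) * (L ^ k)⁻¹ + B * (L ^ 2 / (L ^ 3 - 1)) * L ^ k) := by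
  have hx0 : 0 ≤ (L ^ 2)⁻¹ := by positivity
  have h1 : ∑ l ∈ range k, ((L ^ 2)⁻¹) ^ (k - 1 - l) * r l ≤ C * ∑ l ∈ range k, ((L ^ 2)⁻¹) ^ (k - 1 - l) * M l := by
    rw [mul_sum]
    refine sum_le_sum fun l hl => ?_
    have := mul_le_mul_of_nonneg_left (hr l (mem_range.mp hl)) (pow_nonneg hx0 (k - 1 - l))
    linarith
  have h2 := levelSum_damped_le L hL k A B hA hB M hM
  have h3 := mul_le_mul_of_nonneg_left h2 hC
  calc E * ∑ l ∈ range k, ((L ^ 2)⁻¹) ^ (k - 1 - l) * r l ≤ E * (C * ∑ l ∈ range k, ((L ^ 2)⁻¹) ^ (k - 1 - l) * M l) :=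
        mul_le_mul_of_nonneg_left h1 hE
    _ ≤ E * (C * (A * (L ^ 2 / (L - 1)) * (L ^ k)⁻¹ + B * (L ^ 2 / (L ^ 3 - 1)) * L ^ k)) := mul_le_mul_of_nonneg_left h3 hE
    _ = _ := by ring

/-! ## §3 ★★ The joint currency -/

/-- ★★ **THE JOINT CURRENCY**: with `A = c_A·M₀` and `B = c_B·KD + c_B′·ε·((L^k)²)⁻¹·M₀` (`KD = CURL₀ + DIV₀`; the two summands of `B_Λ²`), the bound of §2 is
`C₁·(L^k)⁻¹·M₀ + C₂·L^k·KD` with `C₁ = E·C·(c_A·L²∕(L−1) + c_B′·ε·L²∕(L³−1))`, `C₂ = E·C·c_B·L²∕(L³−1)` — the door's `C₁ℓ⁻¹M + C₂ℓK` shape, L-only.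
[cite: Balaban1985Variational, Prop. 7 p.299] -/
theorem jointRow_currency (L : ℝ) (hL : 2 ≤ L) (k : ℕ) {cA cB cB' ε C E M₀ KD : ℝ} (hcA : 0 ≤ cA) (hcB : 0 ≤ cB) (hcB' : 0 ≤ cB') (hε : 0 ≤ ε)
    (hC : 0 ≤ C) (hE : 0 ≤ E) (hM₀ : 0 ≤ M₀) (hKD : 0 ≤ KD)
    (M r : ℕ → ℝ) (hM : ∀ l < k, M l ≤ cA * M₀ * (L ^ l)⁻¹ + (cB * KD + cB' * ε * ((L ^ k) ^ 2)⁻¹ * M₀) * L ^ l)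
    (hr : ∀ l < k, r l ≤ C * M l) :
    E * ∑ l ∈ range k, ((L ^ 2)⁻¹) ^ (k - 1 - l) * r l
      ≤ E * C * (cA * (L ^ 2 / (L - 1)) + cB' * ε * (L ^ 2 / (L ^ 3 - 1))) * ((L ^ k)⁻¹ * M₀)
        + E * C * cB * (L ^ 2 / (L ^ 3 - 1)) * (L ^ k * KD) := by
  have hL0 : 0 < L := by linarith
  have hA : 0 ≤ cA * M₀ := mul_nonneg hcA hM₀
  have hB : 0 ≤ cB * KD + cB' * ε * ((L ^ k) ^ 2)⁻¹ * M₀ := by positivity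
  have h := jointRow_of_levelMasses L hL k hA hB hC hE M r hM hr
  have hLk : (L ^ k) ≠ 0 := pow_ne_zero _ hL0.ne'
  have e : E * C * (cA * M₀ * (L ^ 2 / (L - 1)) * (L ^ k)⁻¹ + (cB * KD + cB' * ε * ((L ^ k) ^ 2)⁻¹ * M₀) * (L ^ 2 / (L ^ 3 - 1)) * L ^ k)
      = E * C * (cA * (L ^ 2 / (L - 1)) + cB' * ε * (L ^ 2 / (L ^ 3 - 1))) * ((L ^ k)⁻¹ * M₀)
        + E * C * cB * (L ^ 2 / (L ^ 3 - 1)) * (L ^ k * KD) := by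
    field_simp
    ring
  rw [← e]
  exact h

end Summit.QuantumFields.YangMills.Theorems.Prop7JointRowOfLevelMasses

end
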